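import Summits.QuantumFields.YangMills.Theorems.MirrorModularBoostsHypercubicLimitOfLineInputs
import Summits.QuantumFields.YangMills.Theorems.PencilRigidityWeakCouplingHypercubicLimitSiblingTie
import Summits.QuantumFields.YangMills.Theorems.PencilRigidityWeakCouplingHypercubicLimitStubCountertermBound
import Summits.QuantumFields.YangMills.Theorems.PencilRigidityWeakCouplingHypercubicLimitStubVolumeFloorOfPolyVolume
import HarnessLib

/-!
# Crux `WeakCouplingHypercubicLimit` (stmt-QuantumFields-16120) from the common lattice-side core — the line in one implication

Crux `Summit.QuantumFields.YangMills.Theses.PencilRigidity.WeakCouplingHypercubicLimit` (by `stub_siblingTie` the same statement as the twin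
stmt-16154 `CoincidenceRotationBootstrap.HypercubicLimit`), line `Sketch` (= card trace-norm-cold-pressure), reshape r11 of the continuation
lead c5: the tree-side statement that the crux FOLLOWS from the line's single open input, the COMMON CORE of both cruxes
(`stub_latticeCore` of `Cruxes/WeakCouplingHypercubicLimit/Lines/Sketch.lean`):

  for every compact simple `G` a faithful `r` and a species scheme `sch` with `β_k → ∞`, polynomial volume growth (`PolyVolume`),
  polynomial multiplicative renormalisation (`PolyRenorm`), the `k`-uniform plane-resolved `n!`-moment bounds
  (`UniformMomentBoundsPlanes`) and the infrared inputs (`IRInputs`: uniform lattice gap, RP-spectral clustering, non-triviality and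
  `κ₃` floors).

Compared with the twin's landed `hypercubicLimit_of_lineInputsPlanes` the core here carries NO bounded-counterterm clause: it is DERIVED
(`countertermBound_of_irInputs`, from the landed `stub_countertermBound`: the moment bound at order one on a non-negative bump and the
non-triviality floor force `|m_k| ≤ Cm`), and the UV clause is the moment bound itself rather than the order-one holomorphy it follows from.
Also recorded: the COLD-PRESSURE core of this line (r10/r11 heart: cold pressure on the trace excess of Wilson's transfer semigroup instead of
`IRInputs` (a),(b)) implies the common core (`latticeCore_of_latticeColdCore`: the landed lever `irInputs_of_coldPressure`, the volume floor
from `PolyVolume` by the landed `stub_volumeFloorOfPolyVolume`, `β_k ≥ 0` eventually from weak coupling), hence the crux.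

Chain (all landed): core ⇒ bounded counterterm ⇒ `oneFieldClauses_of_uniformMomentBoundsPlanes` (Z1 `stub_functionalBoundPlanes` ⇒ Z2
`stub_planeLimits` ⇒ soft legs ∧ reflection legs `stub_rpPosOfPlaneLimits` / `stub_signedPermOfPlaneLimits` / `stub_decayOfRPSpectral` ⇒
`oneFieldClauses_of_halves`) ⇒ ONE FIELD SUFFICES (`hypercubicLimit_iff_oneFieldWeak`) ⇒ stmt-16154 ⇒ this crux (`stub_siblingTie`).

Refs: OsterwalderSchrader1973/1975; OsterwalderSeiler1978 §§2–3; GlimmJaffe1987 §6.1, §19; JaffeWitten2000 §§4–6.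
-/

noncomputable section

open scoped SchwartzMap
open MeasureTheory Filter Topology
open Literature.MathematicalPhysics.AQFT Literature.MathematicalPhysics.QuantumLattice
open Literature.MathematicalPhysics.QuantumFieldTheory
open Summit.QuantumFields.YangMills.Cruxes.HypercubicLimit.CouplingResponse

namespace Summit.QuantumFields.YangMills.Theorems.WeakCouplingHypercubicLimit.TraceNormColdPressure

/-- **Bounded counterterms from the core**: the `k`-uniform plane moment bounds and the non-triviality floor (c) of `IRInputs` force
`∃ Cm, ∀ k, |m_k| ≤ Cm` (landed `stub_countertermBound`). [folklore] -/
theorem countertermBound_of_irInputs {G : Type} [Group G] [TopologicalSpace G] [IsTopologicalGroup G] [CompactSpace G]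
    [MeasurableSpace G] [BorelSpace G] (r : LatticeRep G) (sch : SpeciesScheme (YMSpecies G))
    (hUMB : UniformMomentBoundsPlanes r sch) (hIR : IRInputs r sch) :
    ∃ Cm : ℝ, ∀ k, |sch.m r.curvature k| ≤ Cm := by
  obtain ⟨-, ⟨u, v, δ, -, -, hδ, hev⟩, -⟩ := (irInputs_iff r sch).1 hIR
  exact stub_countertermBound G r sch hUMB ⟨u, v, δ, hδ, hev⟩

/-- **The common core gives a weak-coupling one-field witness** (`OneFieldClauses` on a sub-scheme at weak coupling). [folklore] -/
theorem oneFieldClauses_of_latticeCore {G : Type} [Group G] [TopologicalSpace G] [IsTopologicalGroup G] [CompactSpace G]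
    [MeasurableSpace G] [BorelSpace G] (r : LatticeRep G) (sch : SpeciesScheme (YMSpecies G))
    (hw : sch.HasWeakCouplingLimit) (hpv : PolyVolume sch) (hpr : PolyRenorm r sch)
    (hUMB : UniformMomentBoundsPlanes r sch) (hIR : IRInputs r sch) :
    ∃ (sch' : SpeciesScheme (YMSpecies G)) (S₁ : SchwingerFamily (EuclideanSpace ℝ (Fin 4))),
      sch'.HasWeakCouplingLimit ∧ OneFieldClauses r sch' S₁ :=
  oneFieldClauses_of_uniformMomentBoundsPlanes r sch hw hpv hpr (countertermBound_of_irInputs r sch hUMB hIR) hUMB hIR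

/-- **The twin crux `HypercubicLimit` (stmt-16154) from the common core.** [folklore] -/
theorem hypercubicLimit_of_latticeCore
    (h : ∀ (G : Type) [Group G] [TopologicalSpace G] [IsTopologicalGroup G] [CompactSpace G]
      [MeasurableSpace G] [BorelSpace G], IsCompactSimpleLieGroup G →
      ∃ (r : LatticeRep G) (sch : SpeciesScheme (YMSpecies G)),
        sch.HasWeakCouplingLimit ∧ PolyVolume sch ∧ PolyRenorm r sch ∧
        UniformMomentBoundsPlanes r sch ∧ IRInputs r sch) :
    Summit.QuantumFields.YangMills.Theses.CoincidenceRotationBootstrap.HypercubicLimit := by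
  refine Summit.QuantumFields.YangMills.Theorems.HypercubicLimit.OneFieldWeak.hypercubicLimit_iff_oneFieldWeak.mpr
    fun G _ _ _ _ hG => ?_
  letI : MeasurableSpace G := borel G
  haveI : BorelSpace G := ⟨rfl⟩
  obtain ⟨r, sch, hw, hpv, hpr, hUMB, hIR⟩ := h G hG
  obtain ⟨sch', S₁, hw', h₁⟩ := oneFieldClauses_of_latticeCore r sch hw hpv hpr hUMB hIR
  exact ⟨r, sch', S₁, hw', h₁⟩

/-- **The crux `WeakCouplingHypercubicLimit` (stmt-16120) BY NAME from the common core** — the whole line `Sketch` in one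
implication: its single open stub implies the existence-minus-rotations leg of `YangMills` in one-field gauge at weak coupling
(via the twin and `stub_siblingTie`). [folklore] -/
theorem weakCouplingHypercubicLimit_of_latticeCore :
    (∀ (G : Type) [Group G] [TopologicalSpace G] [IsTopologicalGroup G] [CompactSpace G]
      [MeasurableSpace G] [BorelSpace G], IsCompactSimpleLieGroup G →
      ∃ (r : LatticeRep G) (sch : SpeciesScheme (YMSpecies G)),
        sch.HasWeakCouplingLimit ∧ PolyVolume sch ∧ PolyRenorm r sch ∧
        UniformMomentBoundsPlanes r sch ∧ IRInputs r sch) →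
    Summit.QuantumFields.YangMills.Theses.PencilRigidity.WeakCouplingHypercubicLimit := fun h =>
  Summit.QuantumFields.YangMills.Theorems.WeakCouplingHypercubicLimit.SiblingTie.stub_siblingTie.mpr
    (hypercubicLimit_of_latticeCore h)

/-- **The cold-pressure core implies the common core.**  Along a weak-coupling scheme with polynomial volume growth, the
cold-pressure bound on the trace excess of Wilson's transfer semigroup (rate `Δ > 0`, prefactor `C₀ ≥ 0`, cold tori `S' ≥ L_k`,
`S'+1 ≤ 2(m+2)`, eventually in `k`) together with the two floors gives `IRInputs`: the volume floor comes from `PolyVolume`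
(`stub_volumeFloorOfPolyVolume`), `β_k ≥ 0` eventually from `β_k → ∞`, and the lever is the landed `irInputs_of_coldPressure`. [folklore] -/
theorem latticeCore_of_latticeColdCore
    (h : ∀ (G : Type) [Group G] [TopologicalSpace G] [IsTopologicalGroup G] [CompactSpace G]
      [MeasurableSpace G] [BorelSpace G], IsCompactSimpleLieGroup G →
      ∃ (r : LatticeRep G) (sch : SpeciesScheme (YMSpecies G)),
        sch.HasWeakCouplingLimit ∧ PolyVolume sch ∧ PolyRenorm r sch ∧
        UniformMomentBoundsPlanes r sch ∧
        (∃ (u v : 𝓢(EuclideanSpace ℝ (Fin 4), ℝ)) (δ : ℝ),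
          tsupport u ⊆ {y : EuclideanSpace ℝ (Fin 4) | y 0 < 0} ∧
          tsupport v ⊆ {y : EuclideanSpace ℝ (Fin 4) | 0 < y 0} ∧ 0 < δ ∧
          ∀ᶠ k in atTop, δ ≤
            |latticeSchwinger r.ρ sch (fun s => s.F) k (1 + 1) (fun _ => r.curvature) ![u, v] -
              latticeSchwinger r.ρ sch (fun s => s.F) k 1 (fun _ => r.curvature) ![u] *
                latticeSchwinger r.ρ sch (fun s => s.F) k 1 (fun _ => r.curvature) ![v]|) ∧
        (∃ (f g h : 𝓢(EuclideanSpace ℝ (Fin 4), ℝ)) (δ : ℝ),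
          Disjoint (tsupport f) (tsupport g) ∧ Disjoint (tsupport f) (tsupport h) ∧
          Disjoint (tsupport g) (tsupport h) ∧ 0 < δ ∧
          ∀ᶠ k in atTop, δ ≤
            |latticeSchwinger r.ρ sch (fun s => s.F) k 3 (fun _ => r.curvature) ![f, g, h] -
              latticeSchwinger r.ρ sch (fun s => s.F) k 1 (fun _ => r.curvature) ![f] *
                latticeSchwinger r.ρ sch (fun s => s.F) k 2 (fun _ => r.curvature) ![g, h] -
              latticeSchwinger r.ρ sch (fun s => s.F) k 1 (fun _ => r.curvature) ![g] *
                latticeSchwinger r.ρ sch (fun s => s.F) k 2 (fun _ => r.curvature) ![f, h] -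
              latticeSchwinger r.ρ sch (fun s => s.F) k 1 (fun _ => r.curvature) ![h] *
                latticeSchwinger r.ρ sch (fun s => s.F) k 2 (fun _ => r.curvature) ![f, g] +
              2 * (latticeSchwinger r.ρ sch (fun s => s.F) k 1 (fun _ => r.curvature) ![f] *
                latticeSchwinger r.ρ sch (fun s => s.F) k 1 (fun _ => r.curvature) ![g] *
                latticeSchwinger r.ρ sch (fun s => s.F) k 1 (fun _ => r.curvature) ![h])|) ∧
        ∃ Δ C₀ : ℝ, 0 < Δ ∧ 0 ≤ C₀ ∧
          (∀ᶠ k in Filter.atTop, ∀ S' : ℕ, sch.L k ≤ S' → ∀ m : ℕ, S' + 1 ≤ 2 * (m + 2) →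
            traceExcess r.ρ (sch.β k) (2 * S' + 1) (m + 2) ≤
              C₀ * ((2 * S' + 1 : ℕ) : ℝ) ^ 3 * Real.exp (-(Δ * sch.a k * ((m + 2 : ℕ) : ℝ))))) :
    ∀ (G : Type) [Group G] [TopologicalSpace G] [IsTopologicalGroup G] [CompactSpace G]
      [MeasurableSpace G] [BorelSpace G], IsCompactSimpleLieGroup G →
      ∃ (r : LatticeRep G) (sch : SpeciesScheme (YMSpecies G)),
        sch.HasWeakCouplingLimit ∧ PolyVolume sch ∧ PolyRenorm r sch ∧
        UniformMomentBoundsPlanes r sch ∧ IRInputs r sch := by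
  intro G _ _ _ _ _ _ hG
  obtain ⟨r, sch, hw, hpv, hpr, hUMB, hNT, hNG, Δ, C₀, hΔ, hC₀, hP⟩ := h G hG
  obtain ⟨K, hK⟩ := stub_volumeFloorOfPolyVolume (YMSpecies G) sch Δ C₀ hpv hΔ hC₀
  exact ⟨r, sch, hw, hpv, hpr, hUMB,
    irInputs_of_coldPressure r sch (hw.eventually_ge_atTop 0) hΔ hC₀ hK hP hNT hNG⟩

/-- **The crux `WeakCouplingHypercubicLimit` BY NAME from the cold-pressure core** (the r11 heart of line `Sketch` in this line's own
infrared currency: weak coupling ∧ `PolyVolume` ∧ `PolyRenorm` ∧ `UniformMomentBoundsPlanes` ∧ NT floor ∧ `κ₃` floor ∧ cold pressure).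
[folklore] -/
theorem weakCouplingHypercubicLimit_of_latticeColdCore
    (h : ∀ (G : Type) [Group G] [TopologicalSpace G] [IsTopologicalGroup G] [CompactSpace G]
      [MeasurableSpace G] [BorelSpace G], IsCompactSimpleLieGroup G →
      ∃ (r : LatticeRep G) (sch : SpeciesScheme (YMSpecies G)),
        sch.HasWeakCouplingLimit ∧ PolyVolume sch ∧ PolyRenorm r sch ∧
        UniformMomentBoundsPlanes r sch ∧
        (∃ (u v : 𝓢(EuclideanSpace ℝ (Fin 4), ℝ)) (δ : ℝ),
          tsupport u ⊆ {y : EuclideanSpace ℝ (Fin 4) | y 0 < 0} ∧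
          tsupport v ⊆ {y : EuclideanSpace ℝ (Fin 4) | 0 < y 0} ∧ 0 < δ ∧
          ∀ᶠ k in atTop, δ ≤
            |latticeSchwinger r.ρ sch (fun s => s.F) k (1 + 1) (fun _ => r.curvature) ![u, v] -
              latticeSchwinger r.ρ sch (fun s => s.F) k 1 (fun _ => r.curvature) ![u] *
                latticeSchwinger r.ρ sch (fun s => s.F) k 1 (fun _ => r.curvature) ![v]|) ∧
        (∃ (f g h : 𝓢(EuclideanSpace ℝ (Fin 4), ℝ)) (δ : ℝ),
          Disjoint (tsupport f) (tsupport g) ∧ Disjoint (tsupport f) (tsupport h) ∧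
          Disjoint (tsupport g) (tsupport h) ∧ 0 < δ ∧
          ∀ᶠ k in atTop, δ ≤
            |latticeSchwinger r.ρ sch (fun s => s.F) k 3 (fun _ => r.curvature) ![f, g, h] -
              latticeSchwinger r.ρ sch (fun s => s.F) k 1 (fun _ => r.curvature) ![f] *
                latticeSchwinger r.ρ sch (fun s => s.F) k 2 (fun _ => r.curvature) ![g, h] -
              latticeSchwinger r.ρ sch (fun s => s.F) k 1 (fun _ => r.curvature) ![g] *
                latticeSchwinger r.ρ sch (fun s => s.F) k 2 (fun _ => r.curvature) ![f, h] -
              latticeSchwinger r.ρ sch (fun s => s.F) k 1 (fun _ => r.curvature) ![h] *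
                latticeSchwinger r.ρ sch (fun s => s.F) k 2 (fun _ => r.curvature) ![f, g] +
              2 * (latticeSchwinger r.ρ sch (fun s => s.F) k 1 (fun _ => r.curvature) ![f] *
                latticeSchwinger r.ρ sch (fun s => s.F) k 1 (fun _ => r.curvature) ![g] *
                latticeSchwinger r.ρ sch (fun s => s.F) k 1 (fun _ => r.curvature) ![h])|) ∧
        ∃ Δ C₀ : ℝ, 0 < Δ ∧ 0 ≤ C₀ ∧
          (∀ᶠ k in Filter.atTop, ∀ S' : ℕ, sch.L k ≤ S' → ∀ m : ℕ, S' + 1 ≤ 2 * (m + 2) →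
            traceExcess r.ρ (sch.β k) (2 * S' + 1) (m + 2) ≤
              C₀ * ((2 * S' + 1 : ℕ) : ℝ) ^ 3 * Real.exp (-(Δ * sch.a k * ((m + 2 : ℕ) : ℝ))))) :
    Summit.QuantumFields.YangMills.Theses.PencilRigidity.WeakCouplingHypercubicLimit :=
  weakCouplingHypercubicLimit_of_latticeCore (latticeCore_of_latticeColdCore h)

end Summit.QuantumFields.YangMills.Theorems.WeakCouplingHypercubicLimit.TraceNormColdPressure

end
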